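import Summits.AtomisticToContinuum.FouriersLaw.Theses.EmbeddedDrudeMourre
import Literature.MathematicalPhysics.KineticTheory.InfiniteChainSuperstableDynamics
import Literature.MathematicalPhysics.KineticTheory.InfiniteChainInvariantStates
-- import Summits.AtomisticToContinuum.FouriersLaw.Theorems.EmbeddedDrudeMourreGreenKuboContinuationHeatableInfrastructure
-- (p117166, ACCEPTED 2026-08-16T17:1xZ; enable this import and the `exact` below once the farm has built the module —
--  at publication time `lean check` answered remote:stale:unbuilt for it)

/-!
# Line `heated-measure-thermal-exponent` for crux `GreenKuboContinuation` (stmt-AtomisticToContinuum-12597)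

Crux (route `EmbeddedDrudeMourre`, rank 5): for `pinnedChain ω₂ lam β γ` (all `> 0`) and `T₀ > 0`,
Abelian Green–Kubo witnesses `W T` at every `T ∈ (0, T₀)` ⇒ `W T` at every `T > 0`, where
`W T = ∃ μ D κ, Gibbs_T μ ∧ D preserves μ ∧ (∀ t, abs. convergent C) ∧ 0 < κ ∧ T⁻²A(ν) → κ (ν ↓ 0)`,
`A(ν) = ∫₀^∞ e^{-νt} C(t) dt`, `C = D.currentCorrelation μ`.

## The line (idea card `Ideas/heated-measure-thermal-exponent.md`, triage r1: 3 × pass)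

HEAT THE MEASURE, NOT THE DYNAMICS. At fixed couplings the Hamiltonian flow does not depend on `T`:
it is ONE object — the Buttà–Marchioro dynamics on its superstable set `𝒳₀ = bmGood` (Thm 2.1,
PROVED in tree: `OscillatorChain.ButtaMarchioro2016_thm21_chain_holds`, unique on `𝒳₀`, so
"`D.carrier = bmGood`" pins the physical flow) — and only the invariant shift-invariant Gibbs state
`μ_T` moves with `T`. The crux becomes a one-dimensional TRANSPORT problem for the function
`T ↦ A_T(ν)` of ONE heated pair `(D, μ_T)`, seeded ONCE by the corner hypothesis at `T₁ := T₀/2`;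
the modulus that transports is the THERMAL EXPONENT `x(T, ν) = T ∂_T log A_T(ν)` (an exact static
energy-insertion third cumulant, `x = κ₃(H, Q_ν, Q_ν)/(T⟨Q_ν²⟩)` by momentum-reversal parity), used
here only in INTEGRATED, RELATIVE, SIGN-FREE form:

* `stub_heatableInfrastructure` (A, size L, print-level): one dynamics with carrier `bmGood` and,
  at every `T > 0`, a shift-invariant DLR Gibbs state it preserves, with absolutely convergent,
  continuous, `C(0)`-bounded summed current autocorrelation (BM 2016 Thm 2.1/2.2 + (2.6) in tree;
  1-D transfer operator; invariance of tempered Gibbs states under the limit of severed flows).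
* `stub_seedTransfer` (B, size L): the SEAM — a witness at `T₁` (arbitrary Gibbs state, arbitrary
  dynamics, as the crux's hypothesis hands it over) forces the PHYSICAL heated pair at the same `T₁`
  to be a witness (identification: DLR states carrying a conducting invariant dynamics vs the
  shift-invariant superstable one; a.e. uniqueness of the flow on `bmGood`). No transport in `T`.
* `stub_boundedThermalExponent` (K1, the HARDEST, rank-2 content of the card): for two admissible
  heated states at `T, T'` the Abel functionals are comparable, `m·A_{T'}(ν) ≤ A_T(ν)` for all
  `ν ∈ (0, 1]` with `m = m(T, T') > 0` INDEPENDENT OF `ν` — the integrated form of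
  `sup |x(·, ν)| ≤ a` on `[T ∧ T', T ∨ T']` (`m = (T ∨ T'/T ∧ T')^{-a}`, Gronwall in `log T`);
  two-sided by the symmetry `T ↔ T'`; it presupposes neither finiteness nor positivity of any Abel
  limit (harmonic sanity check: `A_T = cT²/ν`, `x ≡ 2`, K1 true while `W` fails everywhere).
* `stub_thermalExponentConverges` (K2′, replaces the card's engine-free K2 as all three triagers
  asked): the RATIO `A_T(ν)/A_{T'}(ν)` has a limit as `ν ↓ 0` — the integrated form of
  "`x(·, ν)` converges as `ν ↓ 0`, locally uniformly" (`log(A_T/A_{T'}) = ∫_{T'}^{T} x(S, ν) dS/S`);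
  it TRANSPORTS EXISTENCE of the Abel limit from the seed and is what positivity/Gronwall cannot
  give (triage evidence `Tight35.thermalExponent_tightness`, `Triage.two_sided_bounds_no_limit`,
  Disproof §6 `abelLimit_not_weakly_closed`). Alternative discharge: the relative all-orders bound
  + `RealVitaliPropagation` of card temperature-blind-vitali-hurwitz (merge proposal of the panel).

`GreenKuboContinuation_of : A → B → K1 → K2′ → GreenKuboContinuation` is proved below (real
analysis of limits; no sorry): seed `A_{T₁}(ν) → κ₁T₁² > 0` (B on the corner witness at
`T₁ = T₀/2`), ratio `→ r` (K2′), `r ≥ m > 0` (K1), hence `T⁻²A_T(ν) → T⁻² r κ₁ T₁² > 0`, and the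
infrastructure clauses of `W T` come from A.

## Disproof used (`Cruxes/GreenKuboContinuation/Disproof.lean`, cdisprove cycle 2 v3)

§1 `continuesAlong_iff_exists` / `not_continuesAlong_lt_one`: the corner is used existentially and
exactly once (B at `T₁ = T₀/2`), and chain input is indispensable — it enters through A (BM flow,
Gibbs states) and the physical stubs K1/K2′; §2b–c (`laxWitness_all_temp`, junk inhabitants,
`not_tendsto_abel_of_junk_integral`): every stub keeps the Gibbs clause and `0 < κ`, the heated
pair is the BM flow on `bmGood` (never `restDynamics`), and the admissibility conjunction carries
continuity + `|C| ≤ C(0)` so that no Abel functional in K1/K2′ is Bochner junk; §2c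
`not_tendsto_of_drude_floor` + barrier `Mazur1969_inequality`: a hidden odd conserved charge at an
interior `T*` makes `A_{T*}(ν) ≍ d/ν`, so K1 FAILS at pairs `(T*, T₁)` — correctly, the line is
not conservation-law blind; §4 `greenKuboContinuation_iff_allT_of_corner`: no stub is
`AbelianGreenKuboAllT` or the crux reworded — A is witness-free infrastructure, B is a
same-temperature identification, K1/K2′ are RELATIVE statements true at the harmonic point where
`W` fails at every `T`; §5 `abelFunctional_smul` / `greenKuboContinuation_iff_ray'`: RAY FORM of
K1 for the MD falsifier — `T⁻²A_T(ν; lam, β) = A_1(ν; lamT, βT)`, so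
`x(T, ν) = 2 + c ∂_c log A_1(ν; lam c, β c)|_{c=T}` and `m(T,T')` is read off unit-temperature
ray scans (kit j005961 of the ideator); §6 `abelLimit_not_weakly_closed`,
`corner_vanishing_not_smooth_rigid`, `no_witness_of_pseudogap`: existence is carried by K2′ (not by
bounds), positivity by K1's lower bound (no pseudogap can open between `T₁` and `T`), nothing
relies on smooth-rigidity. No `_false_without_` theorem or landed `Negative/` lemma exists for this
crux at the time of writing (checked `ledger crux ls`, 2026-08-16).

REV 2 (line lead prover-line-stmt-AtomisticToContinuum-12597-c5-0, 2026-08-16 — seventh lead on the crux, third line of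
the session after `Lines/temperature-blind-vitali-hurwitz-DEAD.md` and `Lines/overlap-rigidity-analytic-continuation-DEAD.md`).
Stub A is CLOSED (wave-1 worker, p117166 `Theorems/EmbeddedDrudeMourreGreenKuboContinuationHeatableInfrastructure.lean`: the BM
flow of `exists_bmDynamics` + the transfer-operator Gibbs family `exists_gibbsFamily_pinnedChain` + `regularTransport_of_shiftInvariant`
+ positive type `currentCorrelation_positiveType_of_carrier_subset_bmGood` + a new reusable `continuous_currentCorrelation_of_mixing_of_locality`)
(kept below under its registered name with a `sorry` ONLY until the farm has built p117166's module; the swap is the commented import + `exact`). Also landed: p117132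
`Theorems/EmbeddedDrudeMourreGreenKuboContinuationOfThermalExponent.lean` (`heatedContinuation_of_thermalExponent`: K1 ∧ K2′ ∧ ONE
conducting temperature ⇒ the heated pair conducts at every `T` — the seam-free content of this composition). THREE registered
stubs remain: B `stub_seedTransfer` (the identification SEAM shared with vitali 3 / overlap 4(i): `stub-misstated` class, curable
only by the planner retype GKC′ of c3 `Restatement.lean`), K1 `stub_boundedThermalExponent` and K2′ `stub_thermalExponentConverges`
(jointly the conjunct's all-`T` Abelian Green–Kubo content on the canonical pair in ν-uniform form; no `Leans on:` entry supplies
the ν-uniform cancellation). Line verdict: `Lines/heated-measure-thermal-exponent-DEAD.md` (L5(c)). Composition unchanged.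
-/

noncomputable section

namespace Summit.AtomisticToContinuum.FouriersLaw.Cruxes.GreenKuboContinuation.HeatedMeasureThermalExponent

open MeasureTheory Filter Set Topology
open Literature.MathematicalPhysics.KineticTheory.HeatConduction

/-- **Stub A — `HeatableInfrastructure`** (CLOSED 2026-08-16 by the c5 lead's wave-1 worker: p117166
`Theorems/EmbeddedDrudeMourreGreenKuboContinuationHeatableInfrastructure.lean`, kept here as the sorry-free
stub name kept, see REV 2; size L; print-level infrastructure, shared in substance
with `FourierGreenKubo.InfiniteVolumeSetup` stmt-0743 and `CurrentTiltQuench.SymmetricSetup`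
stmt-11036, but with ONE dynamics for ALL temperatures). For `pinnedChain ω₂ lam β γ` (all `> 0`)
there is an infinite-volume dynamics `D` whose carrier is the Buttà–Marchioro superstable set
`𝒳₀ = bmGood` (exists and is unique there: `OscillatorChain.ButtaMarchioro2016_thm21_chain_holds`,
`….exists_dynamics_pinnedChain`; the prover chooses the measurable version of the flow off `𝒳₀`)
such that for every `T > 0` some DLR Gibbs state `μ_T` is shift-invariant, carried by `𝒳₀` and
preserved by `D` (superstability estimate (2.3) for the translation-invariant Gibbs state ⇒
`μ_T(𝒳₀ᶜ) = 0` by the PROVED `ButtaMarchioro2016_eq26_chain_holds`; invariance: DLR kernels are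
invariant under the severed flows, pass to the limit flow), with absolutely convergent summed
current autocorrelation `C_T(t) = Σ_x ∫ j₀ (j_x ∘ φ_t) dμ_T` at every `t` (almost-linear light cone,
BM Thm 2.2 `ButtaMarchioro2016_thm22_chain_holds`, + spatial mixing of the 1-D Gibbs state),
`t ↦ C_T(t)` continuous and `|C_T(t)| ≤ C_T(0)` (stationarity + positive-definiteness:
`C_T(t) = ⟪[j], U_t[j]⟫` on Doyon's zero-wavenumber space, cf. `ZeroWavenumberSpace`).
Why it might fail: only by mis-assembly — each clause is standard for tempered states of
superstable 1-D chains; the one unprinted step is invariance of the infinite-volume Gibbs state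
under the BM flow for quartic `V` (LLL 1977 §4 remark (i) is for severed flows).
Sources: ButtaMarchioro2016 (arXiv:1602.01294) Thm 2.1–2.2, (2.6); LanfordLebowitzLieb1977 §4;
Georgii2011 (1-D transfer operator); Doyon2022. -/
theorem stub_heatableInfrastructure :
    ∀ ω₂ lam β γ : ℝ, 0 < ω₂ → 0 < lam → 0 < β → 0 < γ →
      ∃ D : InfiniteChainDynamics (pinnedChain ω₂ lam β γ),
        D.carrier = (pinnedChain ω₂ lam β γ).bmGood ∧
        ∀ T : ℝ, 0 < T → ∃ μ : Measure ChainConfig,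
          ((pinnedChain ω₂ lam β γ).IsChainGibbsMeasure T μ ∧ IsShiftInvariant μ ∧ D.PreservesMeasure μ ∧
          (∀ t : ℝ, D.HasAbsConvergentCorrelation μ t) ∧ Continuous (D.currentCorrelation μ) ∧
          ∀ t : ℝ, |D.currentCorrelation μ t| ≤ D.currentCorrelation μ 0) := by
  -- CLOSED in the tree: `exact Summit.AtomisticToContinuum.FouriersLaw.Theorems.GreenKuboContinuation.HeatedMeasureThermalExponent.stub_heatableInfrastructure`
  -- (p117166); kept as `sorry` here only until the farm has built that module (then: enable the import above + this `exact`).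
  sorry

/-- **Stub B — `SeedTransfer`** (size L; the seam between the crux's hypothesis and the heated
pair; NO transport in `T`). If `pinnedChain ω₂ lam β γ` has ANY Abelian Green–Kubo witness at
`T₁` (arbitrary DLR state `μ₁`, arbitrary `μ₁`-preserving dynamics `D₁` — verbatim the crux's
`W T₁`), then the PHYSICAL heated pair at `T₁` — the BM flow (`D.carrier = bmGood`) with any
admissible shift-invariant Gibbs state `μ` at `T₁` — is itself a witness: `T₁⁻²A_{D,μ}(ν) → κ₁`
for some `κ₁ > 0` (not claimed equal to the witness's `κ`). Intended proof: a DLR state carrying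
an invariant dynamics with summable current correlations and a FINITE Abel limit is the
shift-invariant superstable state (exotic = boundary-condition-at-infinity states add
non-decaying, Drude-type terms to `C`, as the harmonic shifts `φ ↦ φ + h`, `(ω₂+2)h = h₊ + h₋`,
do: there `Σ_x λ^x K_t(x) = T cos(ω(i log λ)t) ≡ T`), and two `μ`-preserving solution flows agree
`μ`-a.e. with the BM flow on `𝒳₀` (uniqueness clause of Thm 2.1); then `C_{D₁,μ₁} = C_{D,μ}`.
Why it might fail: an exotic (non-translation-invariant / non-tempered) DLR state of the pinned
chain carrying a conducting invariant dynamics with a DIFFERENT low-frequency current spectrum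
than the physical state — DLR uniqueness without temperedness is false already for the harmonic
chain (Georgii2011 Ch. 13), so the proof must go through the witness property, not bare DLR
uniqueness. Honours Disproof §2b–c (Gibbs clause and `0 < κ` kept on both sides; junk dynamics
give no witness) and §1 (`∀T₀ ≡ ∃T₀`: used once, at `T₁ = T₀/2`).
Sources: Georgii2011 Ch. 10–11, 13; LanfordLebowitzLieb1977 Thm 3–4; ButtaMarchioro2016 Thm 2.1;
BonettoLebowitzReyBellet2000 §7. -/
theorem stub_seedTransfer :
    ∀ ω₂ lam β γ : ℝ, 0 < ω₂ → 0 < lam → 0 < β → 0 < γ → ∀ T₁ : ℝ, 0 < T₁ →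
      (∃ (μ₁ : Measure ChainConfig) (D₁ : InfiniteChainDynamics (pinnedChain ω₂ lam β γ)) (κ : ℝ),
        (pinnedChain ω₂ lam β γ).IsChainGibbsMeasure T₁ μ₁ ∧ D₁.PreservesMeasure μ₁ ∧
          (∀ t : ℝ, D₁.HasAbsConvergentCorrelation μ₁ t) ∧ 0 < κ ∧
          Tendsto (fun ν : ℝ => (T₁ ^ 2)⁻¹ * ∫ t in Ioi (0 : ℝ), Real.exp (-(ν * t)) * D₁.currentCorrelation μ₁ t)
            (𝓝[>] (0 : ℝ)) (𝓝 κ)) →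
      ∀ (D : InfiniteChainDynamics (pinnedChain ω₂ lam β γ)) (μ : Measure ChainConfig),
        D.carrier = (pinnedChain ω₂ lam β γ).bmGood →
        ((pinnedChain ω₂ lam β γ).IsChainGibbsMeasure T₁ μ ∧ IsShiftInvariant μ ∧ D.PreservesMeasure μ ∧
          (∀ t : ℝ, D.HasAbsConvergentCorrelation μ t) ∧ Continuous (D.currentCorrelation μ) ∧
          ∀ t : ℝ, |D.currentCorrelation μ t| ≤ D.currentCorrelation μ 0) →
        ∃ κ₁ : ℝ, 0 < κ₁ ∧
          Tendsto (fun ν : ℝ => (T₁ ^ 2)⁻¹ * ∫ t in Ioi (0 : ℝ), Real.exp (-(ν * t)) * D.currentCorrelation μ t)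
            (𝓝[>] (0 : ℝ)) (𝓝 κ₁) := by
  sorry

/-- **Stub K1 — `BoundedThermalExponent`** (THE HARDEST STUB; the card's rank-2 crux K1 in
integrated form). For the BM flow `D` and admissible heated states `μ` at `T`, `μ'` at `T'`
(both `> 0`): `∃ m > 0, ∀ ν ∈ (0,1], m · A_{T'}(ν) ≤ A_T(ν)`, `A_T(ν) = ∫₀^∞ e^{-νt} C_T(t) dt` —
the constant is UNIFORM IN `ν` (that is the whole content); by the symmetry `T ↔ T'` the bound is
two-sided. It is the integral of the thermal-exponent bound `|T ∂_T log A_T(ν)| ≤ a` on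
`[T ∧ T', T ∨ T']` (Gronwall in `log T`, `m = (T∨T'/T∧T')^{-a}`), where
`T² ∂_T A_T(ν) = Σ_x Cov_T(h_x ; j₀ R_ν)`, `R_ν = Σ_y ∫₀^∞ e^{-νt} j_y∘φ_t dt` (static energy
insertion under ONE flow: DLR equations of `chainSpecification` + dominated differentiation), and
by `Θ`-parity (`J` odd, `H` even, `Cov_T(H, Q_ν) = 0`) `x = κ₃(H, Q_ν, Q_ν)/(T⟨Q_ν²⟩)` is an
intensive THIRD-CUMULANT ratio — the lead's `--supports` lemmas live there. RELATIVE and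
SIGN-FREE: presupposes neither finiteness nor positivity of any Abel limit (harmonic check
`A_T = cT²/ν`: `x ≡ 2`, K1 true, `W` false everywhere — Disproof §2c `not_tendsto_of_drude_floor`);
anchors: `x → 0` at the kinetic corner (`πg_T(0) ∝ lam⁻²`), `x → 9/4` at the scale-free quartic
end of every ray, `x_stat ∈ [2, 5/2]`. RAY FORM for numerics (Disproof §5 / tree
`abelFunctional_smul`): `x(T,ν) = 2 + c∂_c log A_1(ν; lam c, β c)|_{c=T}`.
Why it might fail: a genuine transport singularity at an interior `T*` — `κ_A` not log-Lipschitz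
(hidden odd conserved charge ⇒ `A_{T*} ≍ d/ν`, Mazur; Klages-type fractal parameter dependence,
known only for parameters in the DYNAMICS, doi:10.1103/physreve.59.5361, arXiv:0801.2413) — or
`ν`-NON-uniformity: `P_ν = (ν/2)(Q₊² + Q₋²)` has support `∼ v/ν`, so the energy shift is naively
`O(1/ν)` and K1 asserts its cancellation to `O(1)`; on rays with `β ≪ lam` the De Roeck–Huveneers
window makes `x` large of both signs (finite) — hence no signed variant is claimed
(barrier `AnticontinuumLocalizationNarrow`: it bites quantitatively, the bet is log-Lipschitz).
Sources: card heated-measure-thermal-exponent; AokiLukkarinenSpohn2006 §3, §5; LiLi2007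
(arXiv:cond-mat/0703567) p.4; KomorowskiLandimOlla2012 Ch. 4 (doi:10.1007/978-3-642-29880-6_4);
BonettoLebowitzReyBellet2000 §6.3 (35); DeRoeckHuveneers2015; Mazur1969. -/
theorem stub_boundedThermalExponent :
    ∀ ω₂ lam β γ : ℝ, 0 < ω₂ → 0 < lam → 0 < β → 0 < γ →
      ∀ (D : InfiniteChainDynamics (pinnedChain ω₂ lam β γ)), D.carrier = (pinnedChain ω₂ lam β γ).bmGood →
      ∀ T T' : ℝ, 0 < T → 0 < T' → ∀ μ μ' : Measure ChainConfig,
        ((pinnedChain ω₂ lam β γ).IsChainGibbsMeasure T μ ∧ IsShiftInvariant μ ∧ D.PreservesMeasure μ ∧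
          (∀ t : ℝ, D.HasAbsConvergentCorrelation μ t) ∧ Continuous (D.currentCorrelation μ) ∧
          ∀ t : ℝ, |D.currentCorrelation μ t| ≤ D.currentCorrelation μ 0) →
        ((pinnedChain ω₂ lam β γ).IsChainGibbsMeasure T' μ' ∧ IsShiftInvariant μ' ∧ D.PreservesMeasure μ' ∧
          (∀ t : ℝ, D.HasAbsConvergentCorrelation μ' t) ∧ Continuous (D.currentCorrelation μ') ∧
          ∀ t : ℝ, |D.currentCorrelation μ' t| ≤ D.currentCorrelation μ' 0) →
        ∃ m : ℝ, 0 < m ∧ ∀ ν : ℝ, ν ∈ Ioc (0 : ℝ) 1 →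
          m * (∫ t in Ioi (0 : ℝ), Real.exp (-(ν * t)) * D.currentCorrelation μ' t) ≤
            ∫ t in Ioi (0 : ℝ), Real.exp (-(ν * t)) * D.currentCorrelation μ t := by
  sorry

/-- **Stub K2′ — `ThermalExponentConverges`** (existence transport; replaces the card's K2 per
triage r1-1/2/3). For the BM flow `D` and admissible heated states `μ` at `T`, `μ'` at `T'`: the
ratio `A_T(ν)/A_{T'}(ν)` converges to a real limit as `ν ↓ 0`. Integrated form of "the thermal
exponent `x(·, ν)` converges as `ν ↓ 0` in `L¹(dS/S)` on `[T∧T', T∨T']`" (e.g. locally uniformly,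
the card's K2′), since `log(A_T(ν)/A_{T'}(ν)) = ∫_{T'}^{T} x(S,ν) dS/S`; spectrally: the Poisson
smoothings at `0` of the current spectral measures `σ_T`, `σ_{T'}` are asymptotically
PROPORTIONAL — a statement about the `T`-dependence of the low-frequency LINESHAPE only. RELATIVE:
true at the harmonic point (ratio `(T/T')²`) where no Abel limit exists at any `T`; it is what
transports EXISTENCE of `lim_ν A_T(ν)` from the seed `T₁` to `T` (bounds cannot:
`Triage.two_sided_bounds_no_limit`, `Tight35.thermalExponent_tightness`, Disproof §6
`abelLimit_not_weakly_closed`). Alternative discharge: relative all-orders (Gevrey-1) bounds on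
`∂ᵏ_{1/T} log A_T(ν)` uniform in `ν` + `RealVitaliPropagation` (card temperature-blind-vitali-hurwitz;
the panel's merge proposal) give convergence of `A_T(ν)` itself on compacts, hence of the ratio.
Why it might fail: persistent `log(1/ν)`-scale oscillation of the running conductivity whose PHASE
depends on `T` (a `T`-dependent version of the density `2 + sin log(1/|ω|)` near `0`): no example
or mechanism is known for a translation-invariant non-integrable chain (for reversible stochastic
perturbations the limit exists by monotonicity — here nothing is monotone); Loomis 1943 /
Karamata–Stieltjes index ½ is the exact equivalence with the symmetric derivative of `σ_T` at `0`.
Sources: card heated-measure-thermal-exponent (K2/K2′); TRIAGE-r1-1/2/3; KomorowskiLandimOlla2012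
Ch. 4; BonettoLebowitzReyBellet2000 §6.3. -/
theorem stub_thermalExponentConverges :
    ∀ ω₂ lam β γ : ℝ, 0 < ω₂ → 0 < lam → 0 < β → 0 < γ →
      ∀ (D : InfiniteChainDynamics (pinnedChain ω₂ lam β γ)), D.carrier = (pinnedChain ω₂ lam β γ).bmGood →
      ∀ T T' : ℝ, 0 < T → 0 < T' → ∀ μ μ' : Measure ChainConfig,
        ((pinnedChain ω₂ lam β γ).IsChainGibbsMeasure T μ ∧ IsShiftInvariant μ ∧ D.PreservesMeasure μ ∧
          (∀ t : ℝ, D.HasAbsConvergentCorrelation μ t) ∧ Continuous (D.currentCorrelation μ) ∧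
          ∀ t : ℝ, |D.currentCorrelation μ t| ≤ D.currentCorrelation μ 0) →
        ((pinnedChain ω₂ lam β γ).IsChainGibbsMeasure T' μ' ∧ IsShiftInvariant μ' ∧ D.PreservesMeasure μ' ∧
          (∀ t : ℝ, D.HasAbsConvergentCorrelation μ' t) ∧ Continuous (D.currentCorrelation μ') ∧
          ∀ t : ℝ, |D.currentCorrelation μ' t| ≤ D.currentCorrelation μ' 0) →
        ∃ r : ℝ, Tendsto (fun ν : ℝ =>
            (∫ t in Ioi (0 : ℝ), Real.exp (-(ν * t)) * D.currentCorrelation μ t) /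
              ∫ t in Ioi (0 : ℝ), Real.exp (-(ν * t)) * D.currentCorrelation μ' t)
          (𝓝[>] (0 : ℝ)) (𝓝 r) := by
  sorry

/-- **Composition (kernel-checked, no `sorry`): A → B → K1 → K2′ → `GreenKuboContinuation`.**
Given the corner hypothesis on `(0, T₀)` and a target `T > 0`: take the heated pair `(D, μ_·)` of
A; seed `T₁ := T₀/2`; B turns the corner witness at `T₁` into `T₁⁻²A_{μ₁}(ν) → κ₁ > 0`; K2′ gives
`A_{μ_T}(ν)/A_{μ₁}(ν) → r`; K1 gives `m A_{μ₁} ≤ A_{μ_T}` on `(0,1]`, so `r ≥ m > 0`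
(`ge_of_tendsto`); hence `A_{μ_T}(ν) = ratio · A_{μ₁}(ν) → r κ₁ T₁²` eventually (where
`A_{μ₁}(ν) > 0`), and `κ := T⁻² r κ₁ T₁² > 0` with the Gibbs / preservation / absolute-convergence
clauses of `W T` supplied by A. -/
theorem GreenKuboContinuation_of :
    (∀ ω₂ lam β γ : ℝ, 0 < ω₂ → 0 < lam → 0 < β → 0 < γ →
      ∃ D : InfiniteChainDynamics (pinnedChain ω₂ lam β γ),
        D.carrier = (pinnedChain ω₂ lam β γ).bmGood ∧
        ∀ T : ℝ, 0 < T → ∃ μ : Measure ChainConfig,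
          ((pinnedChain ω₂ lam β γ).IsChainGibbsMeasure T μ ∧ IsShiftInvariant μ ∧ D.PreservesMeasure μ ∧
          (∀ t : ℝ, D.HasAbsConvergentCorrelation μ t) ∧ Continuous (D.currentCorrelation μ) ∧
          ∀ t : ℝ, |D.currentCorrelation μ t| ≤ D.currentCorrelation μ 0)) →
    (∀ ω₂ lam β γ : ℝ, 0 < ω₂ → 0 < lam → 0 < β → 0 < γ → ∀ T₁ : ℝ, 0 < T₁ →
      (∃ (μ₁ : Measure ChainConfig) (D₁ : InfiniteChainDynamics (pinnedChain ω₂ lam β γ)) (κ : ℝ),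
        (pinnedChain ω₂ lam β γ).IsChainGibbsMeasure T₁ μ₁ ∧ D₁.PreservesMeasure μ₁ ∧
          (∀ t : ℝ, D₁.HasAbsConvergentCorrelation μ₁ t) ∧ 0 < κ ∧
          Tendsto (fun ν : ℝ => (T₁ ^ 2)⁻¹ * ∫ t in Ioi (0 : ℝ), Real.exp (-(ν * t)) * D₁.currentCorrelation μ₁ t)
            (𝓝[>] (0 : ℝ)) (𝓝 κ)) →
      ∀ (D : InfiniteChainDynamics (pinnedChain ω₂ lam β γ)) (μ : Measure ChainConfig),
        D.carrier = (pinnedChain ω₂ lam β γ).bmGood →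
        ((pinnedChain ω₂ lam β γ).IsChainGibbsMeasure T₁ μ ∧ IsShiftInvariant μ ∧ D.PreservesMeasure μ ∧
          (∀ t : ℝ, D.HasAbsConvergentCorrelation μ t) ∧ Continuous (D.currentCorrelation μ) ∧
          ∀ t : ℝ, |D.currentCorrelation μ t| ≤ D.currentCorrelation μ 0) →
        ∃ κ₁ : ℝ, 0 < κ₁ ∧
          Tendsto (fun ν : ℝ => (T₁ ^ 2)⁻¹ * ∫ t in Ioi (0 : ℝ), Real.exp (-(ν * t)) * D.currentCorrelation μ t)
            (𝓝[>] (0 : ℝ)) (𝓝 κ₁)) →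
    (∀ ω₂ lam β γ : ℝ, 0 < ω₂ → 0 < lam → 0 < β → 0 < γ →
      ∀ (D : InfiniteChainDynamics (pinnedChain ω₂ lam β γ)), D.carrier = (pinnedChain ω₂ lam β γ).bmGood →
      ∀ T T' : ℝ, 0 < T → 0 < T' → ∀ μ μ' : Measure ChainConfig,
        ((pinnedChain ω₂ lam β γ).IsChainGibbsMeasure T μ ∧ IsShiftInvariant μ ∧ D.PreservesMeasure μ ∧
          (∀ t : ℝ, D.HasAbsConvergentCorrelation μ t) ∧ Continuous (D.currentCorrelation μ) ∧
          ∀ t : ℝ, |D.currentCorrelation μ t| ≤ D.currentCorrelation μ 0) →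
        ((pinnedChain ω₂ lam β γ).IsChainGibbsMeasure T' μ' ∧ IsShiftInvariant μ' ∧ D.PreservesMeasure μ' ∧
          (∀ t : ℝ, D.HasAbsConvergentCorrelation μ' t) ∧ Continuous (D.currentCorrelation μ') ∧
          ∀ t : ℝ, |D.currentCorrelation μ' t| ≤ D.currentCorrelation μ' 0) →
        ∃ m : ℝ, 0 < m ∧ ∀ ν : ℝ, ν ∈ Ioc (0 : ℝ) 1 →
          m * (∫ t in Ioi (0 : ℝ), Real.exp (-(ν * t)) * D.currentCorrelation μ' t) ≤
            ∫ t in Ioi (0 : ℝ), Real.exp (-(ν * t)) * D.currentCorrelation μ t) →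
    (∀ ω₂ lam β γ : ℝ, 0 < ω₂ → 0 < lam → 0 < β → 0 < γ →
      ∀ (D : InfiniteChainDynamics (pinnedChain ω₂ lam β γ)), D.carrier = (pinnedChain ω₂ lam β γ).bmGood →
      ∀ T T' : ℝ, 0 < T → 0 < T' → ∀ μ μ' : Measure ChainConfig,
        ((pinnedChain ω₂ lam β γ).IsChainGibbsMeasure T μ ∧ IsShiftInvariant μ ∧ D.PreservesMeasure μ ∧
          (∀ t : ℝ, D.HasAbsConvergentCorrelation μ t) ∧ Continuous (D.currentCorrelation μ) ∧
          ∀ t : ℝ, |D.currentCorrelation μ t| ≤ D.currentCorrelation μ 0) →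
        ((pinnedChain ω₂ lam β γ).IsChainGibbsMeasure T' μ' ∧ IsShiftInvariant μ' ∧ D.PreservesMeasure μ' ∧
          (∀ t : ℝ, D.HasAbsConvergentCorrelation μ' t) ∧ Continuous (D.currentCorrelation μ') ∧
          ∀ t : ℝ, |D.currentCorrelation μ' t| ≤ D.currentCorrelation μ' 0) →
        ∃ r : ℝ, Tendsto (fun ν : ℝ =>
            (∫ t in Ioi (0 : ℝ), Real.exp (-(ν * t)) * D.currentCorrelation μ t) /
              ∫ t in Ioi (0 : ℝ), Real.exp (-(ν * t)) * D.currentCorrelation μ' t)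
          (𝓝[>] (0 : ℝ)) (𝓝 r)) →
    Summit.AtomisticToContinuum.FouriersLaw.Theses.EmbeddedDrudeMourre.GreenKuboContinuation := by
  intro hA hB hK1 hK2 ω₂ lam β γ hω hl hβ hγ T₀ hT₀ hcorner T hT
  -- the heated pair: ONE dynamics (BM flow on `bmGood`) and shift-invariant Gibbs states at every T
  obtain ⟨D, hDc, hfam⟩ := hA ω₂ lam β γ hω hl hβ hγ
  -- seed temperature inside the corner, used exactly once
  have hT₁ : (0 : ℝ) < T₀ / 2 := by positivity
  have hT₁lt : T₀ / 2 < T₀ := by linarith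
  obtain ⟨μ₁, hμ₁⟩ := hfam (T₀ / 2) hT₁
  obtain ⟨μT, hμT⟩ := hfam T hT
  -- B: the physical pair at T₁ is a witness
  obtain ⟨κ₁, hκ₁, hseed⟩ :=
    hB ω₂ lam β γ hω hl hβ hγ (T₀ / 2) hT₁ (hcorner (T₀ / 2) hT₁ hT₁lt) D μ₁ hDc hμ₁
  -- K1 and K2′ at the pair (T, T₁)
  obtain ⟨m, hm, hbound⟩ := hK1 ω₂ lam β γ hω hl hβ hγ D hDc T (T₀ / 2) hT hT₁ μT μ₁ hμT hμ₁
  obtain ⟨r, hr⟩ := hK2 ω₂ lam β γ hω hl hβ hγ D hDc T (T₀ / 2) hT hT₁ μT μ₁ hμT hμ₁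
  -- real analysis of the transport
  have hT₁sq : (0 : ℝ) < (T₀ / 2) ^ 2 := by positivity
  -- the seed Abel functional tends to L₁ := (T₀/2)² κ₁ > 0
  have hA₁ : Tendsto (fun ν : ℝ => ∫ t in Ioi (0 : ℝ),
      Real.exp (-(ν * t)) * D.currentCorrelation μ₁ t) (𝓝[>] (0 : ℝ)) (𝓝 ((T₀ / 2) ^ 2 * κ₁)) := by
    have h := hseed.const_mul ((T₀ / 2) ^ 2)
    refine h.congr' (Eventually.of_forall fun ν => ?_)
    simp only
    rw [← mul_assoc, mul_inv_cancel₀ hT₁sq.ne', one_mul]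
  have hL₁ : (0 : ℝ) < (T₀ / 2) ^ 2 * κ₁ := mul_pos hT₁sq hκ₁
  -- eventually the seed functional is positive and ν ∈ (0, 1]
  have hpos : ∀ᶠ ν : ℝ in 𝓝[>] (0 : ℝ), 0 < ∫ t in Ioi (0 : ℝ),
      Real.exp (-(ν * t)) * D.currentCorrelation μ₁ t := hA₁.eventually_const_lt hL₁
  have hν : ∀ᶠ ν : ℝ in 𝓝[>] (0 : ℝ), ν ∈ Ioc (0 : ℝ) 1 := Ioc_mem_nhdsGT one_pos
  -- r ≥ m > 0
  have hmr : m ≤ r := by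
    refine ge_of_tendsto hr ?_
    filter_upwards [hpos, hν] with ν hp hn
    rw [le_div_iff₀ hp]
    exact hbound ν hn
  have hrpos : 0 < r := lt_of_lt_of_le hm hmr
  -- the target Abel functional tends to r · L₁
  have hAT : Tendsto (fun ν : ℝ => ∫ t in Ioi (0 : ℝ),
      Real.exp (-(ν * t)) * D.currentCorrelation μT t) (𝓝[>] (0 : ℝ))
      (𝓝 (r * ((T₀ / 2) ^ 2 * κ₁))) := by
    refine (hr.mul hA₁).congr' ?_
    filter_upwards [hpos] with ν hp
    exact div_mul_cancel₀ _ hp.ne'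
  -- assemble the witness at T
  refine ⟨μT, D, (T ^ 2)⁻¹ * (r * ((T₀ / 2) ^ 2 * κ₁)), hμT.1, hμT.2.2.1, hμT.2.2.2.1,
    mul_pos (inv_pos.mpr (pow_pos hT 2)) (mul_pos hrpos hL₁), ?_⟩
  exact hAT.const_mul ((T ^ 2)⁻¹)

/-- Sanity link for the audit: the composition applied to the four stubs proves the crux decl by
name (this term carries the stubs' sorries and is NOT a proof claim). -/
theorem GreenKuboContinuation_proof :
    Summit.AtomisticToContinuum.FouriersLaw.Theses.EmbeddedDrudeMourre.GreenKuboContinuation :=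
  GreenKuboContinuation_of stub_heatableInfrastructure stub_seedTransfer stub_boundedThermalExponent
    stub_thermalExponentConverges

end Summit.AtomisticToContinuum.FouriersLaw.Cruxes.GreenKuboContinuation.HeatedMeasureThermalExponent

end
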